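import Mathlib
import Mathlib.Geometry.Manifold.Instances.Real
import Mathlib.Analysis.InnerProductSpace.PiL2
import Literature.Geometry.Lorentzian.NullInfinity
import Literature.Geometry.Lorentzian.Genericity
import Literature.Geometry.Lorentzian.AsymptoticFlatness
import Literature.Geometry.Lorentzian.Development
import Literature.Geometry.Lorentzian.Extension
import Literature.Geometry.Lorentzian.FinalState
import Literature.Geometry.Lorentzian.SphericalEinsteinScalar
import Literature.Geometry.Lorentzian.WeightedNorms
import HarnessLib.Audit
import Literature.Geometry.Lorentzian.CosmicCensorship
import HarnessLib

/-!
# WeakCosmicCensorship — CONJECTURE (obligation of FinalStateConjecture/FinalStateConjecture)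

Unproven conjecture migrated by the gate from `Literature/Geometry/Lorentzian/CosmicCensorship.lean` (`Literature.Geometry.Lorentzian.WeakCosmicCensorship`): unproven conjectures are obligations of our
theories, not literature facts (human ruling 2026-08-15). Provenance: Christodoulou1999. Routes use it as a crux item or via
`--conditional-bridge --conditional-on WeakCosmicCensorship`; a proof goes in the sibling `Theorems/WeakCosmicCensorshipHolds.lean` as `theorem WeakCosmicCensorship_holds : WeakCosmicCensorship` so this file stays a conjecture LEAF that Literature/ may import.
-/

namespace Summit.FinalStateConjecture.FinalStateConjecture

open Literature Literature.Geometry Literature.Geometry.Lorentzian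
open Manifold Bundle TopologicalSpace
open scoped ContDiff Topology

/-- OPEN CONJECTURE — **gr.S02, weak cosmic censorship** (Christodoulou's formulation for
vacuum), posed — after Penrose's informal "singularities are cloaked by event horizons" (Riv.
Nuovo Cim. 1 (1969) 252) — in Christodoulou, CQG 16 (1999) A23–A35, p. A27 (completeness of
future null infinity for generic data, "generic" = exceptional set of positive codimension);
summits/gr-wcc/SUMMIT.md. For every connected (Hausdorff, second countable) `3`-manifold `Σ`,
the property "every maximal globally hyperbolic vacuum development possesses a complete future
null infinity" (intrinsic sojourn formulation, `Development.HasCompleteFutureNullInfinity`,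
gr.S16) is generic in the admissible class `𝓓 = IsAdmissibleWCCData Σ` in Christodoulou's sense:
the exceptional set `𝓔 = {D ∈ 𝓓 | some MGHD of D has incomplete 𝓘⁺}` has positive codimension
(`≥ 1`) inside `𝓓` (`InitialDataSet.IsChristodoulouGeneric … 1`). Status: OPEN — "Proving weak
cosmic censorship for (1.1) without symmetry assumptions is a fundamental open problem in
classical general relativity" (Dafermos–Luk, arXiv:1710.01722, §1.1.1; the formulation "is given
a definitive form in" Christodoulou 1999, ibid. footnote 3); "The present formulation is taken
from Christodoulou [CQG 1999]" (Dafermos–Rodnianski, arXiv:0811.0354, §2.6.2); the generic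
version "is the currently accepted formulation" (Rodnianski–Shlapentokh-Rothman, arXiv:1912.08478,
§1.1). Proved only in the spherically symmetric Einstein–scalar-field model (Christodoulou, Ann.
of Math. 149 (1999); see
`Literature/Barriers/FinalStateConjecture/NakedSingularityInstability.lean`).
Registered here as an open statement (CONVENTIONS §4), not literature debt: no
`WeakCosmicCensorship_holds` is to be expected; users take `(h : WeakCosmicCensorship)`. The name
is kept (quoted in the barrier file above; see the module docstring, "Verdict clean-up") rather
than renamed `…Conjecture`; the statement is unchanged.
[cite: Christodoulou1999, p. A27] [status: open] -/
@[conjecture] def WeakCosmicCensorship : Prop :=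
  ∀ (X : Type) [TopologicalSpace X] [ChartedSpace E3 X] [IsManifold (𝓡 3) ∞ X] [T2Space X]
    [SecondCountableTopology X] [ConnectedSpace X],
    InitialDataSet.IsChristodoulouGeneric (IsAdmissibleWCCData X)
      (fun D ↦ ∀ 𝒟 : VacuumDevelopment D, 𝒟.IsMaximal →
        𝒟.toDevelopment.HasCompleteFutureNullInfinity) 1

end Summit.FinalStateConjecture.FinalStateConjecture
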